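import Summits.QuantumFields.YangMills.Theorems.LuscherReductionTwistedTraceScalingBTOffDiagonalNear
import Summits.QuantumFields.YangMills.Theorems.LuscherReductionTwistedTraceScalingBTWindow
import HarnessLib

/-!
# The CORE PAIR SANDWICH: for a near pair in the slow window and a conj-invariant core weight,
# `e^{−η}(1 − ε₂)·C ≤ fpBOKernel(u,u')/K₁(u,u') ≤ e^{η}(1 + ε₂ + (ε₁+ε₂)²)·C`, `C = fpBOKernel(1,1)/K₁(1,1)`, with `η, ε₁, ε₂` EXPLICIT in the window/core radii
# (lane A of S-BASE, crux `TwistedTraceScaling` stmt-QuantumFields-20203, C4-CORE, the (B-T) pen; design note `pub/ym-fleet/ym-luscher-20007-p1/COARSE-DESIGN.md` §25.9)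

This combines (L3) `…BTDiagonalIntegral.fpBOKernel_diag_two_sided` and (L2) `…BTOffDiagonalNear.fpBOKernel_near_two_sided`, discharging their pointwise hypotheses from the simple
support data: window `‖q(u_k) − 1‖, ‖q(u'_k) − 1‖ ≤ δ ≤ 1/2`, near `‖q(u_k) − q(u'_k)‖ ≤ α ≤ 1`, fibre support `|v_{e,c}| ≤ t ≤ T`, `‖v̂‖ ≤ R`, gauge core `‖q(g_x) − 1‖ ≤ T ≤ 1/30`,
pinned colour sum `‖Σ_x g⃗_x‖ ≤ Γ`, one-site actions `≤ σ < 2` (all from `…BTWindow`):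
* `coreEps1 β δ T R`, `coreEps2 β δ T R σ`, `coreEta β δ α T R Γ σ` — the explicit rates;
* ★★★ `core_pair_two_sided` — the sandwich.  With the schedule of record (`δ ≍ β^{-s}`, `α, T, R ≍ β^{-1/2}log β`, `Γ ≍ β^{-1}N`, `σ ≍ β^{-4s}`) all three rates are
  `O(β^{-2s}log²β + β^{-1/2}log³β)` and `(ε₁+ε₂)² = O(β^{-2s}log⁴β)` — inside `κ = β^{-2s}log⁵β = o(bareLambda)` iff `s > 1/6`.
HONEST FRAMING: bookkeeping for a stub of a child of the CONDITIONAL reduction route R2b1; rates and the assembly through `hT_of_fp_add` remain; C4-CORE OPEN; not infinite volume, not a gap, not Clay.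
-/

set_option autoImplicit false

noncomputable section

open MeasureTheory Filter Topology Real
open scoped BigOperators Matrix Quaternion
open Literature.MathematicalPhysics.QuantumFieldTheory
open Literature.MathematicalPhysics.QuantumLattice

namespace Summit.QuantumFields.YangMills.Theorems.FemtoTransferGap.TwoLattice.ConstTube

open Summit.QuantumFields.YangMills.Theorems.FemtoTransferGap
open Summit.QuantumFields.YangMills.Theorems.FemtoTransferGap.TwoLattice
open Summit.QuantumFields.YangMills.Theorems.FemtoTransferGap.TwoLattice.Avg
open Summit.QuantumFields.YangMills.Theorems.FemtoTransferGap.TwoLattice.Stiff (LinkSpace)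
open Summit.QuantumFields.YangMills.Theorems.FemtoTransferGap.TwoLattice.Cov

variable (L : ℕ) [NeZero L]

/-- **(L3) first-order rate** `ε₁ = β(288|E|δT² + 160δN_P R²)`. [folklore] -/
def coreEps1 (β δ T R : ℝ) : ℝ :=
  β * (12 * ((Fintype.card (Edge 3 L) : ℝ) * ((2 * δ) * T * (12 * T)))) + β * (40 * (2 * δ) * (Fintype.card (Plaquette 3 L × Fin 3) : ℝ) * (R ^ 2 + R ^ 2))

/-- **(L3) second-order rate** `ε₂`. [folklore] -/
def coreEps2 (β δ T R σ : ℝ) : ℝ :=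
  β * (48 * ((Fintype.card (Edge 3 L) : ℝ) * (δ ^ 2 * T * (12 * T)))) +
    2 * (β / 2 * ((σ / 2 * (10 * Real.sqrt (Fintype.card (Plaquette 3 L × Fin 3)) * R) ^ 2 + stepActionErr (L := L) T σ) + stepActionErr (L := L) T 0 +
      145000000 * (Fintype.card (Plaquette 3 L × Fin 3) : ℝ) * δ ^ 2 * R ^ 2))

/-- **(L2) near-pair rate** `η`. [folklore] -/
def coreEta (β δ α T R Γ σ : ℝ) : ℝ :=
  β * ((Fintype.card (Edge 3 L) : ℝ) * (558 * α ^ 2 * T ^ 2 + 192 * α * T ^ 2) + 216 * α * δ * Γ) +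
    β / 2 * (100 * σ * (Fintype.card (Plaquette 3 L × Fin 3) : ℝ) * R ^ 2 + 2 * stepActionErr (L := L) T σ + 10080 * α * (Fintype.card (Plaquette 3 L × Fin 3) : ℝ) * R ^ 2)

variable {L}

/-- ★★★ **THE CORE PAIR SANDWICH.** [cite: Luscher1983, §3] -/
theorem core_pair_two_sided {β : ℝ} (hβ : 0 ≤ β) {Ω : LinkSpace L → ℝ} (hΩm : Measurable Ω) {CΩ : ℝ} (hCΩ : ∀ x, |Ω x| ≤ CΩ) (hΩ0 : ∀ x, 0 ≤ Ω x)
    (hΩinv : ∀ (g : SU2) (x : LinkSpace L), Ω (adL L g x) = Ω x) {W : (Site 3 L → SU2) → ℝ} (hW : Measurable W) {CW : ℝ} (hCW : ∀ g, |W g| ≤ CW) (hW0 : ∀ g, 0 ≤ W g)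
    (hWinv : ∀ (c : SU2) (g : Site 3 L → SU2), W (fun x => c * g x * c⁻¹) = W g) (u u' : GaugeConfig 3 1 SU2) {δ α t T R Γ σ : ℝ}
    (hδ : ∀ k : Fin 3, ‖su2Quat (u (0, k)) - 1‖ ≤ δ) (hδ1 : δ ≤ 1 / 2) (hα : ∀ k : Fin 3, ‖su2Quat (u (0, k)) - su2Quat (u' (0, k))‖ ≤ α) (hα1 : α ≤ 1)
    (htT : t ≤ T) (hT : T ≤ 1 / 30) (hσ : σ < 2) (hσ0 : 0 ≤ σ) (hS : (L : ℝ) ^ 3 * wilsonAction su2Rep u ≤ σ) (hS' : (L : ℝ) ^ 3 * wilsonAction su2Rep u' ≤ σ)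
    (hΩt : ∀ v : Edge 3 L → Fin 3 → ℝ, Ω (linkEmbed L v) ≠ 0 → (∀ (e : Edge 3 L) (c : Fin 3), |v e c| ≤ t) ∧ ‖linkEmbed L v‖ ≤ R)
    (hWc : ∀ g : Site 3 L → SU2, W g ≠ 0 → (∀ x, ‖su2Quat (g x) - 1‖ ≤ T) ∧ ‖∑ x, vecPart (g x)‖ ≤ Γ)
    (hε : coreEps1 L β δ T R + coreEps2 L β δ T R σ ≤ 1) :
    Real.exp (-coreEta L β δ α T R Γ σ) * (1 - coreEps2 L β δ T R σ) *
        (fpBOKernel L β Ω W 1 1 / transferKernel su2Rep ((L : ℝ) ^ 3 * β) (1 : GaugeConfig 3 1 SU2) 1) ≤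
        fpBOKernel L β Ω W u u' / transferKernel su2Rep ((L : ℝ) ^ 3 * β) u u' ∧
      fpBOKernel L β Ω W u u' / transferKernel su2Rep ((L : ℝ) ^ 3 * β) u u' ≤
        Real.exp (coreEta L β δ α T R Γ σ) * (1 + coreEps2 L β δ T R σ + (coreEps1 L β δ T R + coreEps2 L β δ T R σ) ^ 2) *
          (fpBOKernel L β Ω W 1 1 / transferKernel su2Rep ((L : ℝ) ^ 3 * β) (1 : GaugeConfig 3 1 SU2) 1) := by
  -- sizes of the slow data
  have hδ0 : 0 ≤ δ := (norm_nonneg _).trans (hδ 0)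
  have hδ1' : δ ≤ 1 := by linarith
  have hα0 : 0 ≤ α := (norm_nonneg _).trans (hα 0)
  have hu2 : ∀ k : Fin 3, ∑ a, vecPart (u (0, k)) a ^ 2 ≤ δ ^ 2 := fun k =>
    (sum_sq_vecPart_le_norm_sub_one_sq _).trans (pow_le_pow_left₀ (norm_nonneg _) (hδ k) 2)
  have hun : ∀ k : Fin 3, ‖vecPart (u (0, k))‖ ≤ δ := fun k => (norm_vecPart_le_norm_sub_one _).trans (hδ k)
  have ha : ∀ (k : Fin 3) (c : Fin 3), |vecPart (u (0, k) * (u' (0, k))⁻¹) c| ≤ α := fun k c => by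
    refine (abs_vecPart_le_norm_sub_one _ c).trans ?_
    rw [norm_su2Quat_mul_inv_sub_one]; exact hα k
  have hw0 : ∀ k : Fin 3, 0 ≤ scalarPart (u (0, k) * (u' (0, k))⁻¹) := fun k =>
    scalarPart_mul_inv_nonneg (by nlinarith [pow_le_pow_left₀ (norm_nonneg _) ((hα k).trans hα1) 2, norm_nonneg (su2Quat (u (0, k)) - su2Quat (u' (0, k)))])
  -- support data in the shapes the two engines want
  have hΩT : ∀ v : Edge 3 L → Fin 3 → ℝ, Ω (linkEmbed L v) ≠ 0 → (∀ (e : Edge 3 L) (c : Fin 3), |v e c| ≤ T) ∧ ‖linkEmbed L v‖ ≤ R := fun v hv =>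
    ⟨fun e c => ((hΩt v hv).1 e c).trans htT, (hΩt v hv).2⟩
  have hWc' : ∀ g : Site 3 L → SU2, W g ≠ 0 → (∀ x, 0 ≤ scalarPart (g x)) ∧ (∀ x, ∑ c, vecPart (g x) c ^ 2 ≤ T ^ 2) ∧ ‖∑ x, vecPart (g x)‖ ≤ Γ := fun g hg =>
    ⟨fun x => scalarPart_nonneg_of_norm_sub_one_le (((hWc g hg).1 x).trans (by linarith)),
      fun x => (sum_sq_vecPart_le_norm_sub_one_sq _).trans (pow_le_pow_left₀ (norm_nonneg _) ((hWc g hg).1 x) 2), (hWc g hg).2⟩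
  -- (L2)
  have hnear := fpBOKernel_near_two_sided hβ hΩm hCΩ hΩ0 hW hCW hW0 u u' hT hσ hS hS' hα1 ha hw0 hun hΩT hWc'
  -- (L3): discharge the pointwise ε-hypotheses on the supports
  have hM : ∀ (v v' : Edge 3 L → Fin 3 → ℝ) (g : Site 3 L → SU2), Ω (linkEmbed L v) ≠ 0 → Ω (linkEmbed L v') ≠ 0 → W g ≠ 0 → ∀ e : Edge 3 L,
      ‖vecPart (g (e.1.shift e.2))‖ * ‖vecPart (linkM L v v' g e)‖ ≤ T * (12 * T) := by
    intro v v' g hv hv' hg e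
    have hvT := (hΩT v hv).1
    have hv'T := (hΩT v' hv').1
    have hgT := (hWc g hg).1
    have hT0 : 0 ≤ T := (abs_nonneg _).trans (hvT e 0)
    have hve : ‖v e‖ ≤ T := (pi_norm_le_iff_of_nonneg hT0).mpr fun c => by rw [Real.norm_eq_abs]; exact hvT e c
    have hv'e : ‖v' e‖ ≤ T := (pi_norm_le_iff_of_nonneg hT0).mpr fun c => by rw [Real.norm_eq_abs]; exact hv'T e c
    have hsq : ∀ w : Fin 3 → ℝ, (∀ c, |w c| ≤ T) → ∑ a, w a ^ 2 ≤ 1 := fun w hw => by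
      rw [Fin.sum_univ_three]
      have b0 := pow_le_pow_left₀ (abs_nonneg _) (hw 0) 2
      have b1 := pow_le_pow_left₀ (abs_nonneg _) (hw 1) 2
      have b2 := pow_le_pow_left₀ (abs_nonneg _) (hw 2) 2
      rw [sq_abs] at b0 b1 b2
      nlinarith
    have hMe := norm_vecPart_linkM_le (hsq (v e) (hvT e)) (hsq (v' e) (hv'T e)) (g e.1)
    have hg1 : ‖vecPart (g e.1)‖ ≤ T := (norm_vecPart_le_norm_sub_one _).trans (hgT e.1)
    have hgy : ‖vecPart (g (e.1.shift e.2))‖ ≤ T := (norm_vecPart_le_norm_sub_one _).trans (hgT _)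
    have hM' : ‖vecPart (linkM L v v' g e)‖ ≤ 12 * T := by unfold linkM; linarith
    exact mul_le_mul hgy hM' (norm_nonneg _) hT0
  have hR2 : ∀ v : Edge 3 L → Fin 3 → ℝ, Ω (linkEmbed L v) ≠ 0 → ‖linkEmbed L v‖ ^ 2 ≤ R ^ 2 := fun v hv => pow_le_pow_left₀ (norm_nonneg _) (hΩT v hv).2 2
  have hE0 : (0 : ℝ) ≤ Fintype.card (Edge 3 L) := Nat.cast_nonneg _
  have hN0 : (0 : ℝ) ≤ Fintype.card (Plaquette 3 L × Fin 3) := Nat.cast_nonneg _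
  have hε₁ : ∀ (v v' : Edge 3 L → Fin 3 → ℝ) (g : Site 3 L → SU2), Ω (linkEmbed L v) ≠ 0 → Ω (linkEmbed L v') ≠ 0 → W g ≠ 0 →
      β * (12 * ∑ e : Edge 3 L, (2 * δ) * ‖vecPart (g (e.1.shift e.2))‖ * ‖vecPart (linkM L v v' g e)‖) +
        β * (40 * (2 * δ) * (Fintype.card (Plaquette 3 L × Fin 3) : ℝ) * (‖linkEmbed L v‖ ^ 2 + ‖linkEmbed L v'‖ ^ 2)) ≤ coreEps1 L β δ T R := by
    intro v v' g hv hv' hg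
    unfold coreEps1
    have hs : ∑ e : Edge 3 L, (2 * δ) * ‖vecPart (g (e.1.shift e.2))‖ * ‖vecPart (linkM L v v' g e)‖ ≤ (Fintype.card (Edge 3 L) : ℝ) * ((2 * δ) * T * (12 * T)) := by
      refine (Finset.sum_le_sum fun e _ => ?_).trans (by rw [Finset.sum_const, Finset.card_univ, nsmul_eq_mul])
      have := mul_le_mul_of_nonneg_left (hM v v' g hv hv' hg e) (by positivity : (0 : ℝ) ≤ 2 * δ)
      linarith [this]
    have h2 := add_le_add (hR2 v hv) (hR2 v' hv')
    linarith [mul_le_mul_of_nonneg_left hs (by positivity : (0 : ℝ) ≤ β * 12), mul_le_mul_of_nonneg_left h2 (by positivity : (0 : ℝ) ≤ β * (40 * (2 * δ) * (Fintype.card (Plaquette 3 L × Fin 3) : ℝ)))]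
  have hε₂ : ∀ (v v' : Edge 3 L → Fin 3 → ℝ) (g : Site 3 L → SU2), Ω (linkEmbed L v) ≠ 0 → Ω (linkEmbed L v') ≠ 0 → W g ≠ 0 →
      β * (48 * ∑ e : Edge 3 L, δ ^ 2 * ‖vecPart (g (e.1.shift e.2))‖ * ‖vecPart (linkM L v v' g e)‖) +
        β / 2 * ((σ / 2 * (10 * Real.sqrt (Fintype.card (Plaquette 3 L × Fin 3)) * ‖linkEmbed L v‖) ^ 2 + stepActionErr (L := L) T σ) + stepActionErr (L := L) T 0 +
          145000000 * (Fintype.card (Plaquette 3 L × Fin 3) : ℝ) * δ ^ 2 * ‖linkEmbed L v‖ ^ 2) +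
        β / 2 * ((σ / 2 * (10 * Real.sqrt (Fintype.card (Plaquette 3 L × Fin 3)) * ‖linkEmbed L v'‖) ^ 2 + stepActionErr (L := L) T σ) + stepActionErr (L := L) T 0 +
          145000000 * (Fintype.card (Plaquette 3 L × Fin 3) : ℝ) * δ ^ 2 * ‖linkEmbed L v'‖ ^ 2) ≤ coreEps2 L β δ T R σ := by
    intro v v' g hv hv' hg
    unfold coreEps2
    have hs : ∑ e : Edge 3 L, δ ^ 2 * ‖vecPart (g (e.1.shift e.2))‖ * ‖vecPart (linkM L v v' g e)‖ ≤ (Fintype.card (Edge 3 L) : ℝ) * (δ ^ 2 * T * (12 * T)) := by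
      refine (Finset.sum_le_sum fun e _ => ?_).trans (by rw [Finset.sum_const, Finset.card_univ, nsmul_eq_mul])
      have := mul_le_mul_of_nonneg_left (hM v v' g hv hv' hg e) (by positivity : (0 : ℝ) ≤ δ ^ 2)
      linarith [this]
    have hsq : ∀ w : Edge 3 L → Fin 3 → ℝ, Ω (linkEmbed L w) ≠ 0 →
        (σ / 2 * (10 * Real.sqrt (Fintype.card (Plaquette 3 L × Fin 3)) * ‖linkEmbed L w‖) ^ 2 + stepActionErr (L := L) T σ) + stepActionErr (L := L) T 0 +
          145000000 * (Fintype.card (Plaquette 3 L × Fin 3) : ℝ) * δ ^ 2 * ‖linkEmbed L w‖ ^ 2 ≤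
        (σ / 2 * (10 * Real.sqrt (Fintype.card (Plaquette 3 L × Fin 3)) * R) ^ 2 + stepActionErr (L := L) T σ) + stepActionErr (L := L) T 0 +
          145000000 * (Fintype.card (Plaquette 3 L × Fin 3) : ℝ) * δ ^ 2 * R ^ 2 := by
      intro w hw
      have hwR := (hΩT w hw).2
      have h1 : (10 * Real.sqrt (Fintype.card (Plaquette 3 L × Fin 3)) * ‖linkEmbed L w‖) ^ 2 ≤ (10 * Real.sqrt (Fintype.card (Plaquette 3 L × Fin 3)) * R) ^ 2 :=
        pow_le_pow_left₀ (by positivity) (mul_le_mul_of_nonneg_left hwR (by positivity)) 2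
      have h2 := hR2 w hw
      linarith [mul_le_mul_of_nonneg_left h1 (by positivity : (0 : ℝ) ≤ σ / 2),
        mul_le_mul_of_nonneg_left h2 (by positivity : (0 : ℝ) ≤ 145000000 * (Fintype.card (Plaquette 3 L × Fin 3) : ℝ) * δ ^ 2)]
    have h1 := hsq v hv
    have h2 := hsq v' hv'
    linarith [mul_le_mul_of_nonneg_left hs (by positivity : (0 : ℝ) ≤ β * 48), mul_le_mul_of_nonneg_left h1 (by positivity : (0 : ℝ) ≤ β / 2),
      mul_le_mul_of_nonneg_left h2 (by positivity : (0 : ℝ) ≤ β / 2)]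
  have hΩT' : ∀ v : Edge 3 L → Fin 3 → ℝ, Ω (linkEmbed L v) ≠ 0 → ∀ (e : Edge 3 L) (c : Fin 3), |v e c| ≤ T := fun v hv => (hΩT v hv).1
  have hdiag := fpBOKernel_diag_two_sided hβ hΩm hCΩ hΩ0 hΩinv hW hCW hW0 hWinv u hT hσ hσ0 hS hΩT' hδ0 hδ1' hu2 hε hε₁ hε₂
  -- combine
  have hexp0 : 0 ≤ Real.exp (-coreEta L β δ α T R Γ σ) := (Real.exp_pos _).le
  have hexp1 : 0 ≤ Real.exp (coreEta L β δ α T R Γ σ) := (Real.exp_pos _).le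
  constructor
  · calc Real.exp (-coreEta L β δ α T R Γ σ) * (1 - coreEps2 L β δ T R σ) * (fpBOKernel L β Ω W 1 1 / transferKernel su2Rep ((L : ℝ) ^ 3 * β) 1 1)
        = Real.exp (-coreEta L β δ α T R Γ σ) * ((1 - coreEps2 L β δ T R σ) * (fpBOKernel L β Ω W 1 1 / transferKernel su2Rep ((L : ℝ) ^ 3 * β) 1 1)) := by ring
      _ ≤ Real.exp (-coreEta L β δ α T R Γ σ) * (fpBOKernel L β Ω W u u / transferKernel su2Rep ((L : ℝ) ^ 3 * β) u u) := mul_le_mul_of_nonneg_left hdiag.1 hexp0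
      _ ≤ _ := hnear.1
  · calc fpBOKernel L β Ω W u u' / transferKernel su2Rep ((L : ℝ) ^ 3 * β) u u'
        ≤ Real.exp (coreEta L β δ α T R Γ σ) * (fpBOKernel L β Ω W u u / transferKernel su2Rep ((L : ℝ) ^ 3 * β) u u) := hnear.2
      _ ≤ Real.exp (coreEta L β δ α T R Γ σ) * ((1 + coreEps2 L β δ T R σ + (coreEps1 L β δ T R + coreEps2 L β δ T R σ) ^ 2) *
            (fpBOKernel L β Ω W 1 1 / transferKernel su2Rep ((L : ℝ) ^ 3 * β) 1 1)) := mul_le_mul_of_nonneg_left hdiag.2 hexp1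
      _ = _ := by ring

end Summit.QuantumFields.YangMills.Theorems.FemtoTransferGap.TwoLattice.ConstTube

end
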